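import Summits.Ventures.QEC.CircuitDistance.PortStructure
import Summits.Ventures.QEC.CircuitDistance.SchedCleanCycle
import HarnessLib

/-!
# Q4 lane, ₛ-spine (2): the SINGLE-FAULT STRUCTURE THEOREM for any CNOT order, and linearity over an arbitrary event list
# (venture QEC, experiment cell CDX; drafted by qec-cdx-idea-2 g2 against `SchedCleanCycle.lean` (`SMSchedule.CycleFacts`, `shapeₛ`),
# typed by qec-cdx-type-2, statement audit qec-cdx-crit-1 (director-qec R158); the `PortStructure.lean` layer of record re-pointed
# from `cycleEvents` to `cycleEventsₛ σ`; nothing here asserts a value of `d_circ`)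

* `run1Fₛ σ S Nc f` and **`run1ₛ_eq`** (STRUCTURE THEOREM under `hσ : σ.CycleFacts S`): for a fault in cycle `c ∈ [1, Nc]`,
  `run1ₛ σ S Nc f = Gen.run1 S (allEventsₛ σ Nc) f` is the closed formula of `PortStructure.run1F` in the one-cycle shape
  `shapeₛ σ S f` — proof verbatim from `run1_eq_aux` with `evolve_cycleEvents ↦ hσ.clean`, `mem_cycleEvents_iff ↦ hσ.mem_iff`;
  `run1ₛ_of_not_mem`;
* LINEARITY stated ONCE at `Gen` level over an arbitrary event list `es` (proofs verbatim from `PortStructure.lean` with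
  `run1 S Nc ↦ Gen.run1 S es`): `Gen.flipZ/flipX_singleton`, `Gen.flipZ/flipX_eq_bsum`, `Gen.dataX/dataZ_eq_sum`,
  `Gen.dataX/dataZ_singleton_run1`, `Gen.detZ/detX_eq_bsum`; and `dataXₛ_singleton` / `dataZₛ_singleton` (= the shape's data bits,
  via `run1ₛ_eq`).
Generic in `σ` and `S`.
-/

namespace Summit.Ventures.QEC.CircuitDistance

open Literature.InformationTheory.QuantumCodes

variable {ℓ m : ℕ} [NeZero ℓ] [NeZero m]

/-! ## SINGLE-FAULT STRUCTURE THEOREM under a schedule -/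

/-- The closed formula for the final state of the `Nc`-cycle circuit with one fault (cycle `c = f.cyc ∈ [1, Nc]`):
outcome flips `μ` of the shape in cycle `c`; cycle `c+1` reads `ζ ⊕ synZ(Eˣ)` / `synX(Eᶻ)`; later cycles the true
syndromes; frame = the shape's frame if `Nc = c`, else its cleaned version. -/
def run1Fₛ (σ : SMSchedule) (S : SMCode ℓ m) (Nc : ℕ) (f : Fault ℓ m) : State ℓ m :=
  ⟨if Nc = f.cyc then (shapeₛ σ S f).frame else cleanFrame S (shapeₛ σ S f).frame,
   fun t i => if f.cyc < t ∧ t ≤ Nc then synX S (shapeₛ σ S f).frame.dataZb i else (shapeₛ σ S f).mX t i,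
   fun t j => if f.cyc < t ∧ t ≤ Nc then
      xor (if t = f.cyc + 1 then (shapeₛ σ S f).frame.ancZx j else false) (synZ S (shapeₛ σ S f).frame.dataXb j)
    else (shapeₛ σ S f).mZ t j⟩

/-- The formula's frame keeps the shape's data `x`-bits. -/
theorem run1Fₛ_dataXb (σ : SMSchedule) (S : SMCode ℓ m) (Nc : ℕ) (f : Fault ℓ m) :
    (run1Fₛ σ S Nc f).frame.dataXb = (shapeₛ σ S f).frame.dataXb := by
  unfold run1Fₛ; dsimp only; split_ifs
  · rfl
  · exact cleanFrame_dataXb S _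

/-- The formula's frame keeps the shape's data `z`-bits. -/
theorem run1Fₛ_dataZb (σ : SMSchedule) (S : SMCode ℓ m) (Nc : ℕ) (f : Fault ℓ m) :
    (run1Fₛ σ S Nc f).frame.dataZb = (shapeₛ σ S f).frame.dataZb := by
  unfold run1Fₛ; dsimp only; split_ifs
  · rfl
  · exact cleanFrame_dataZb S _

/-- The formula's `Z`-ancilla `x`-bits: the shape's in the fault's own cycle, clear afterwards. -/
theorem run1Fₛ_ancZx (σ : SMSchedule) (S : SMCode ℓ m) (Nc : ℕ) (f : Fault ℓ m) (j : BB.Mono ℓ m) :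
    (run1Fₛ σ S Nc f).frame.ancZx j = if Nc = f.cyc then (shapeₛ σ S f).frame.ancZx j else false := by
  unfold run1Fₛ; dsimp only; split_ifs
  · rfl
  · rfl

/-- The formula's frame has `z`-clear `Z`-ancillas. -/
theorem run1Fₛ_Zz (σ : SMSchedule) (S : SMCode ℓ m) (Nc : ℕ) (f : Fault ℓ m) (j : BB.Mono ℓ m) : ((run1Fₛ σ S Nc f).frame (Reg.Z, j)).2 = false := by
  unfold run1Fₛ; dsimp only; split_ifs
  · exact shapeₛ_ancZz σ S f j
  · rfl

/-- Cleaning the formula's frame gives the cleaned shape frame. -/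
theorem cleanFrame_run1Fₛ (σ : SMSchedule) (S : SMCode ℓ m) (Nc : ℕ) (f : Fault ℓ m) :
    cleanFrame S (run1Fₛ σ S Nc f).frame = cleanFrame S (shapeₛ σ S f).frame := by
  unfold run1Fₛ; dsimp only; split_ifs
  · rfl
  · exact cleanFrame_cleanFrame S _

/-- A fault whose event is not in the circuit has no effect. -/
theorem run1ₛ_of_not_mem (σ : SMSchedule) (S : SMCode ℓ m) (Nc : ℕ) (f : Fault ℓ m) (h : f.ev ∉ allEventsₛ σ Nc) :
    run1ₛ σ S Nc f = State.init := by
  unfold run1ₛ Gen.run1; rw [simulate_of_not_mem S f h]; exact evolve_init S _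

/-- The structure theorem, inductive form. -/
theorem run1ₛ_eq_aux {σ : SMSchedule} {S : SMCode ℓ m} (hσ : σ.CycleFacts S) (f : Fault ℓ m) (h₁ : 1 ≤ f.cyc) (n : ℕ) :
    run1ₛ σ S (f.cyc + n) f = run1Fₛ σ S (f.cyc + n) f := by
  induction n with
  | zero =>
    unfold run1ₛ Gen.run1
    obtain ⟨c₀, hc₀⟩ : ∃ c₀, f.cyc = c₀ + 1 := ⟨f.cyc - 1, by omega⟩
    have hnot : f.ev ∉ allEventsₛ σ c₀ := by rw [hσ.mem_allEventsₛ_iff, Fault.ev_cyc]; omega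
    rw [add_zero, hc₀, allEventsₛ_succ, simulate_append, simulate_of_not_mem S f hnot, evolve_init]
    have hsh : simulate S f (cycleEventsₛ σ (c₀ + 1)) State.init = shapeₛ σ S f := by unfold shapeₛ; rw [hc₀]
    rw [hsh]; unfold run1Fₛ
    refine State.ext' ?_ ?_ ?_
    · simp [hc₀]
    · funext t i; dsimp only; rw [if_neg]; omega
    · funext t j; dsimp only; rw [if_neg]; omega
  | succ n ih =>
    unfold run1ₛ Gen.run1 at ih ⊢
    have hnot : f.ev ∉ cycleEventsₛ σ (f.cyc + n + 1) := by rw [hσ.mem_iff, Fault.ev_cyc]; omega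
    rw [← add_assoc, allEventsₛ_succ, simulate_append, ih, simulate_of_not_mem S f hnot,
      hσ.clean _ _ (run1Fₛ_Zz σ S _ f)]
    have hmX : ∀ t i, (run1Fₛ σ S (f.cyc + n) f).mX t i =
        if f.cyc < t ∧ t ≤ f.cyc + n then synX S (shapeₛ σ S f).frame.dataZb i else (shapeₛ σ S f).mX t i := fun _ _ => rfl
    have hmZ : ∀ t j, (run1Fₛ σ S (f.cyc + n) f).mZ t j =
        if f.cyc < t ∧ t ≤ f.cyc + n then
          xor (if t = f.cyc + 1 then (shapeₛ σ S f).frame.ancZx j else false) (synZ S (shapeₛ σ S f).frame.dataXb j)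
        else (shapeₛ σ S f).mZ t j := fun _ _ => rfl
    refine State.ext' ?_ ?_ ?_
    · rw [cleanFrame_run1Fₛ]; unfold run1Fₛ; dsimp only; rw [if_neg]; omega
    · funext t i
      dsimp only
      rw [run1Fₛ_dataZb, hmX]
      show _ = (if f.cyc < t ∧ t ≤ f.cyc + n + 1 then synX S (shapeₛ σ S f).frame.dataZb i else (shapeₛ σ S f).mX t i)
      by_cases ht : t = f.cyc + n + 1
      · subst ht
        have e1 : ¬ (f.cyc < f.cyc + n + 1 ∧ f.cyc + n + 1 ≤ f.cyc + n) := by omega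
        have e2 : (f.cyc < f.cyc + n + 1 ∧ f.cyc + n + 1 ≤ f.cyc + n + 1) := by omega
        have e3 : f.cyc + n + 1 ≠ f.cyc := by omega
        rw [if_pos rfl, if_neg e1, if_pos e2, shapeₛ_mX_of_ne σ S f e3, Bool.false_xor]
      · rw [if_neg ht]
        by_cases h2 : f.cyc < t ∧ t ≤ f.cyc + n
        · have h3 : f.cyc < t ∧ t ≤ f.cyc + n + 1 := by omega
          rw [if_pos h2, if_pos h3]
        · have h3 : ¬ (f.cyc < t ∧ t ≤ f.cyc + n + 1) := by omega
          rw [if_neg h2, if_neg h3]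
    · funext t j
      dsimp only
      rw [run1Fₛ_dataXb, run1Fₛ_ancZx, hmZ]
      show _ = (if f.cyc < t ∧ t ≤ f.cyc + n + 1 then
          xor (if t = f.cyc + 1 then (shapeₛ σ S f).frame.ancZx j else false) (synZ S (shapeₛ σ S f).frame.dataXb j)
        else (shapeₛ σ S f).mZ t j)
      by_cases ht : t = f.cyc + n + 1
      · subst ht
        have e1 : ¬ (f.cyc < f.cyc + n + 1 ∧ f.cyc + n + 1 ≤ f.cyc + n) := by omega
        have e2 : (f.cyc < f.cyc + n + 1 ∧ f.cyc + n + 1 ≤ f.cyc + n + 1) := by omega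
        have e3 : f.cyc + n + 1 ≠ f.cyc := by omega
        rw [if_pos rfl, if_neg e1, if_pos e2, shapeₛ_mZ_of_ne σ S f e3, Bool.false_xor]
        by_cases hn : n = 0
        · subst hn; simp
        · have e4 : ¬ f.cyc + n = f.cyc := by omega
          have e5 : ¬ f.cyc + n + 1 = f.cyc + 1 := by omega
          rw [if_neg e4, if_neg e5]
      · rw [if_neg ht]
        by_cases h2 : f.cyc < t ∧ t ≤ f.cyc + n
        · have h3 : f.cyc < t ∧ t ≤ f.cyc + n + 1 := by omega
          rw [if_pos h2, if_pos h3]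
        · have h3 : ¬ (f.cyc < t ∧ t ≤ f.cyc + n + 1) := by omega
          rw [if_neg h2, if_neg h3]

/-- **STRUCTURE THEOREM.** For a fault in cycle `c ∈ [1, Nc]` the final state of the `Nc`-cycle circuit is the closed
formula `run1F` in its one-cycle shape. -/
theorem run1ₛ_eq {σ : SMSchedule} {S : SMCode ℓ m} (hσ : σ.CycleFacts S) (Nc : ℕ) (f : Fault ℓ m) (h₁ : 1 ≤ f.cyc) (h₂ : f.cyc ≤ Nc) :
    run1ₛ σ S Nc f = run1Fₛ σ S Nc f := by
  obtain ⟨n, rfl⟩ : ∃ n, Nc = f.cyc + n := ⟨Nc - f.cyc, by omega⟩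
  exact run1ₛ_eq_aux hσ f h₁ n

/-- The structure theorem, `Gen.run1` form (the event list `allEventsₛ σ Nc` spelled out; `run1ₛ` unfolded). -/
theorem run1ₛ_eq' {σ : SMSchedule} {S : SMCode ℓ m} (hσ : σ.CycleFacts S) (Nc : ℕ) (f : Fault ℓ m) (h₁ : 1 ≤ f.cyc)
    (h₂ : f.cyc ≤ Nc) : Gen.run1 S (allEventsₛ σ Nc) f = run1Fₛ σ S Nc f :=
  run1ₛ_eq hσ Nc f h₁ h₂

/-! ## Linearity over fault sets, for an arbitrary event list -/

/-- One fault's `Z`-outcome flips. -/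
theorem Gen.flipZ_singleton (S : SMCode ℓ m) (es : List Ev) (f : Fault ℓ m) (t : ℕ) (j : BB.Mono ℓ m) :
    Gen.flipZ S es {f} t j = (Gen.run1 S es f).mZ t j := by
  unfold Gen.flipZ; rw [bsum_singleton]

/-- One fault's `X`-outcome flips. -/
theorem Gen.flipX_singleton (S : SMCode ℓ m) (es : List Ev) (f : Fault ℓ m) (t : ℕ) (i : BB.Mono ℓ m) :
    Gen.flipX S es {f} t i = (Gen.run1 S es f).mX t i := by
  unfold Gen.flipX; rw [bsum_singleton]

/-- Outcome flips are linear in the fault set (`Z`). -/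
theorem Gen.flipZ_eq_bsum (S : SMCode ℓ m) (es : List Ev) (F : Finset (Fault ℓ m)) (t : ℕ) (j : BB.Mono ℓ m) :
    Gen.flipZ S es F t j = bsum F (fun f => Gen.flipZ S es {f} t j) := by
  unfold Gen.flipZ; exact bsum_congr (fun f _ => (bsum_singleton f (fun f' => (Gen.run1 S es f').mZ t j)).symm)

/-- Outcome flips are linear in the fault set (`X`). -/
theorem Gen.flipX_eq_bsum (S : SMCode ℓ m) (es : List Ev) (F : Finset (Fault ℓ m)) (t : ℕ) (i : BB.Mono ℓ m) :
    Gen.flipX S es F t i = bsum F (fun f => Gen.flipX S es {f} t i) := by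
  unfold Gen.flipX; exact bsum_congr (fun f _ => (bsum_singleton f (fun f' => (Gen.run1 S es f').mX t i)).symm)

/-- The residual `X`-error is the sum of the single-fault residuals. -/
theorem Gen.dataX_eq_sum (S : SMCode ℓ m) (es : List Ev) (F : Finset (Fault ℓ m)) :
    Gen.dataX S es F = ∑ f ∈ F, Gen.dataX S es {f} := by
  have h : Gen.dataX S es F = toZ2 (fun q => bsum F fun f => ((Gen.run1 S es f).frame (q.elim (fun i => (Reg.L, i)) fun i => (Reg.R, i))).1) := rfl
  rw [h, toZ2_bsum]
  apply Finset.sum_congr rfl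
  intro f _
  funext q; unfold Gen.dataX toZ2; rw [bsum_singleton]

/-- The residual `Z`-error is the sum of the single-fault residuals. -/
theorem Gen.dataZ_eq_sum (S : SMCode ℓ m) (es : List Ev) (F : Finset (Fault ℓ m)) :
    Gen.dataZ S es F = ∑ f ∈ F, Gen.dataZ S es {f} := by
  have h : Gen.dataZ S es F = toZ2 (fun q => bsum F fun f => ((Gen.run1 S es f).frame (q.elim (fun i => (Reg.L, i)) fun i => (Reg.R, i))).2) := rfl
  rw [h, toZ2_bsum]
  apply Finset.sum_congr rfl
  intro f _
  funext q; unfold Gen.dataZ toZ2; rw [bsum_singleton]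

/-- Residual `X`-error of one fault = data `x`-bits of its final frame. -/
theorem Gen.dataX_singleton_run1 (S : SMCode ℓ m) (es : List Ev) (f : Fault ℓ m) :
    Gen.dataX S es {f} = toZ2 (Gen.run1 S es f).frame.dataXb := by
  funext q; unfold Gen.dataX toZ2 Frame.dataXb; rw [bsum_singleton]

/-- Residual `Z`-error of one fault = data `z`-bits of its final frame. -/
theorem Gen.dataZ_singleton_run1 (S : SMCode ℓ m) (es : List Ev) (f : Fault ℓ m) :
    Gen.dataZ S es {f} = toZ2 (Gen.run1 S es f).frame.dataZb := by
  funext q; unfold Gen.dataZ toZ2 Frame.dataZb; rw [bsum_singleton]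

/-- Residual `X`-error of one fault inside the circuit = data `x`-bits of its SHAPE. -/
theorem dataXₛ_singleton {σ : SMSchedule} {S : SMCode ℓ m} (hσ : σ.CycleFacts S) (Nc : ℕ) (f : Fault ℓ m) (h₁ : 1 ≤ f.cyc) (h₂ : f.cyc ≤ Nc) :
    Gen.dataX S (allEventsₛ σ Nc) {f} = toZ2 (shapeₛ σ S f).frame.dataXb := by
  rw [Gen.dataX_singleton_run1, run1ₛ_eq' hσ Nc f h₁ h₂, run1Fₛ_dataXb]

/-- Residual `Z`-error of one fault inside the circuit = data `z`-bits of its shape. -/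
theorem dataZₛ_singleton {σ : SMSchedule} {S : SMCode ℓ m} (hσ : σ.CycleFacts S) (Nc : ℕ) (f : Fault ℓ m) (h₁ : 1 ≤ f.cyc) (h₂ : f.cyc ≤ Nc) :
    Gen.dataZ S (allEventsₛ σ Nc) {f} = toZ2 (shapeₛ σ S f).frame.dataZb := by
  rw [Gen.dataZ_singleton_run1, run1ₛ_eq' hσ Nc f h₁ h₂, run1Fₛ_dataZb]

/-- `Z`-check detectors are `𝔽₂`-linear in the fault set. -/
theorem Gen.detZ_eq_bsum (S : SMCode ℓ m) (Nc : ℕ) (es : List Ev) (F : Finset (Fault ℓ m)) (t : ℕ) (j : BB.Mono ℓ m) :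
    Gen.detZ S Nc es F t j = bsum F (fun f => Gen.detZ S Nc es {f} t j) := by
  unfold Gen.detZ
  split_ifs with h0 h1 h2
  · rw [bsum_false]
  · rw [Gen.flipZ_eq_bsum S es F t, Gen.flipZ_eq_bsum S es F (t - 1), ← bsum_xor]
  · have : ∀ (G : Finset (Fault ℓ m)), decide ((S.toCode.HZ.mulVec (∑ f ∈ G, Gen.dataX S es {f})) j = 1) =
        bsum G (fun f => decide ((S.toCode.HZ.mulVec (Gen.dataX S es {f})) j = 1)) := by
      intro G
      induction G using Finset.induction_on with
      | empty => simp
      | insert a G ha ih =>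
        rw [Finset.sum_insert ha, Matrix.mulVec_add, Pi.add_apply, bsum_insert ha, ← ih]
        generalize (S.toCode.HZ.mulVec (Gen.dataX S es {a})) j = x
        generalize (S.toCode.HZ.mulVec (∑ f ∈ G, Gen.dataX S es {f})) j = y
        revert x y; decide
    rw [Gen.dataX_eq_sum, this F, Gen.flipZ_eq_bsum S es F Nc, ← bsum_xor]
  · rw [bsum_false]

/-- `X`-check detectors are `𝔽₂`-linear in the fault set. -/
theorem Gen.detX_eq_bsum (S : SMCode ℓ m) (Nc : ℕ) (es : List Ev) (F : Finset (Fault ℓ m)) (t : ℕ) (i : BB.Mono ℓ m) :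
    Gen.detX S Nc es F t i = bsum F (fun f => Gen.detX S Nc es {f} t i) := by
  unfold Gen.detX
  split_ifs with h0 h1 h2
  · rw [bsum_false]
  · rw [Gen.flipX_eq_bsum S es F t, Gen.flipX_eq_bsum S es F (t - 1), ← bsum_xor]
  · have : ∀ (G : Finset (Fault ℓ m)), decide ((S.toCode.HX.mulVec (∑ f ∈ G, Gen.dataZ S es {f})) i = 1) =
        bsum G (fun f => decide ((S.toCode.HX.mulVec (Gen.dataZ S es {f})) i = 1)) := by
      intro G
      induction G using Finset.induction_on with
      | empty => simp
      | insert a G ha ih =>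
        rw [Finset.sum_insert ha, Matrix.mulVec_add, Pi.add_apply, bsum_insert ha, ← ih]
        generalize (S.toCode.HX.mulVec (Gen.dataZ S es {a})) i = x
        generalize (S.toCode.HX.mulVec (∑ f ∈ G, Gen.dataZ S es {f})) i = y
        revert x y; decide
    rw [Gen.dataZ_eq_sum, this F, Gen.flipX_eq_bsum S es F Nc, ← bsum_xor]
  · rw [bsum_false]

end Summit.Ventures.QEC.CircuitDistance
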